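import Mathlib.Analysis.Convex.Slope
import Summits.HubbardSuperconductivity.HubbardSuperconductivity.Theorems.JosephsonMirrorFeynmanHellmann
import Summits.HubbardSuperconductivity.HubbardSuperconductivity.Theses.JosephsonMirror
import Literature.MathematicalPhysics.QuantumLattice.HubbardGaugeBound

/-!
# Route `JosephsonMirror` — crux `JmInterchange` (stmt-HubbardSuperconductivity-2227), line `Sketch` (lead c5):
# the coupling range `J₀` of the hypothesis is idle

The hypothesis of `JmInterchange` is linear Josephson gain `a J L² ≤ E_L(0) − E_L(J)` of the window double for
all couplings `J` in a range `(0, J₀]` (pointwise onset `L₀(J)`).  Because `J ↦ E_L(J)` is concave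
(`minEnergyOn_windowDouble_concaveOn`), the secant slope `(E_L(0) − E_L(J))/J` is non-decreasing in `J > 0`, so
gain at ONE coupling `J₀` with onset `L₀` propagates to EVERY larger coupling with the SAME onset
(`gain_mono_coupling`, `gainHyp_mono_range`).  Hence the range parameter `J₀` of the crux carries no information:
`JmInterchange` is equivalent to its instance `J₀ = 1` (`jmInterchange_iff_unitRange`), i.e. the crux reads
`∀ (U, δ, a): [∀ J ∈ (0, 1] ∃ L₀ ∀ even L ≥ L₀: a J L² ≤ E_L(0) − E_L(J)] → floor pair bridge at (U, δ)`.
(The companion facts — `GainHyp ⟺` zero-excess pair order up to constants, p106153/p110212, and the exact normal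
form `JmInterchange ⟺ (R1 ∧ R2′)`, p127245 — are untouched; this file only removes the quantifier over `J₀` exactly,
with no loss in the constant `a`.)

Sources: T. Koma, H. Tasaki, J. Stat. Phys. 76 (1994) 745 (concavity of the ground-state energy in a source and the
monotone family `(E(0) − E(J))/J`); H. Tasaki, *Physics and Mathematics of Quantum Many-Body Systems* (2020) §2.1.
Pure convex-analysis bookkeeping over landed theorems; no new definitions.
-/

-- the mandated namespace `Summit.<Summit>.<Problem>.Theorems` repeats `HubbardSuperconductivity`
-- (single-problem summit, D-0017), which the `dupNamespace` linter flags on every declaration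
set_option linter.dupNamespace false

namespace Summit.HubbardSuperconductivity.HubbardSuperconductivity.Theorems.JosephsonMirror

open Matrix Literature.MathematicalPhysics.QuantumLattice
open scoped Kronecker
open Summit.HubbardSuperconductivity.HubbardSuperconductivity.Theses.JosephsonMirror (JmInterchange)

section Abstract

variable {ι : Type*} [Fintype ι] [DecidableEq ι]

/-- On the zero subspace the sector energy is the junk value `sInf ∅ = 0`. [folklore] -/
theorem minEnergyOn_bot_eq_zero {n : Type*} [Fintype n] (A : Matrix n n ℂ) :
    A.minEnergyOn (⊥ : Submodule ℂ (n → ℂ)) = 0 := by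
  have hempty : {E : ℝ | ∃ ψ ∈ (⊥ : Submodule ℂ (n → ℂ)), star ψ ⬝ᵥ ψ = 1 ∧
      E = (star ψ ⬝ᵥ A *ᵥ ψ).re} = ∅ := by
    ext E
    simp only [Set.mem_setOf_eq, Set.mem_empty_iff_false, iff_false, not_exists, not_and]
    intro ψ hψ h1 _
    rw [Submodule.mem_bot] at hψ
    subst hψ
    simp at h1
  rw [Matrix.minEnergyOn, hempty, Real.sInf_empty]

/-- **The Josephson gain propagates up in the coupling with the same onset.**  For the window double
`H(J) = A ⊗ 1 + 1 ⊗ Aᵀ − J (D ⊗ D̄ + Dᴴ ⊗ D̄ᴴ)` (`A` Hermitian) on any subspace `S` and `E(J) = minEnergyOn (H(J)) S`: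
if `c J₀ ≤ E(0) − E(J₀)` at some coupling `J₀ > 0`, then `c J ≤ E(0) − E(J)` at every `J ≥ J₀` — the secant slope
`(E(0) − E(J))/J` of the concave `E` is non-decreasing.  (For `S = ⊥` all energies are the junk value `0` and the
claim is `c ≤ 0 ⇒ c J ≤ 0`.)  Koma–Tasaki, J. Stat. Phys. 76 (1994) 745. [folklore] -/
theorem gain_mono_coupling {A : Matrix ι ι ℂ} (hA : A.IsHermitian) (D : Matrix ι ι ℂ)
    (S : Submodule ℂ (ι × ι → ℂ)) {c J₀ J : ℝ} (hJ₀ : 0 < J₀) (hJ : J₀ ≤ J)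
    (h : c * J₀ ≤
      (A ⊗ₖ (1 : Matrix ι ι ℂ) + (1 : Matrix ι ι ℂ) ⊗ₖ Aᵀ -
            ((0 : ℝ) : ℂ) • (D ⊗ₖ Dᴴᵀ + Dᴴ ⊗ₖ Dᵀ)).minEnergyOn S -
        (A ⊗ₖ (1 : Matrix ι ι ℂ) + (1 : Matrix ι ι ℂ) ⊗ₖ Aᵀ -
            (J₀ : ℂ) • (D ⊗ₖ Dᴴᵀ + Dᴴ ⊗ₖ Dᵀ)).minEnergyOn S) :
    c * J ≤
      (A ⊗ₖ (1 : Matrix ι ι ℂ) + (1 : Matrix ι ι ℂ) ⊗ₖ Aᵀ -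
            ((0 : ℝ) : ℂ) • (D ⊗ₖ Dᴴᵀ + Dᴴ ⊗ₖ Dᵀ)).minEnergyOn S -
        (A ⊗ₖ (1 : Matrix ι ι ℂ) + (1 : Matrix ι ι ℂ) ⊗ₖ Aᵀ -
            (J : ℂ) • (D ⊗ₖ Dᴴᵀ + Dᴴ ⊗ₖ Dᵀ)).minEnergyOn S := by
  -- the energy as a function of the coupling
  set f : ℝ → ℝ := fun x =>
    (A ⊗ₖ (1 : Matrix ι ι ℂ) + (1 : Matrix ι ι ℂ) ⊗ₖ Aᵀ -
        (x : ℂ) • (D ⊗ₖ Dᴴᵀ + Dᴴ ⊗ₖ Dᵀ)).minEnergyOn S with hf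
  change c * J₀ ≤ f 0 - f J₀ at h
  change c * J ≤ f 0 - f J
  have hJpos : 0 < J := lt_of_lt_of_le hJ₀ hJ
  by_cases hS : S = ⊥
  · -- junk case: every energy is `0`
    have hf0 : ∀ x, f x = 0 := fun x => by
      simp only [hf, hS]
      exact minEnergyOn_bot_eq_zero _
    rw [hf0, hf0] at h ⊢
    have hc : c ≤ 0 := by nlinarith
    nlinarith
  · -- concave case: secant slopes through `0` are antitone
    have hconc : ConcaveOn ℝ Set.univ f := minEnergyOn_windowDouble_concaveOn hA D hS
    have hconv : ConvexOn ℝ Set.univ (-f) := hconc.neg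
    rcases eq_or_lt_of_le hJ with rfl | hlt
    · exact h
    have hsec := hconv.secant_mono (a := 0) (x := J₀) (y := J) (Set.mem_univ _) (Set.mem_univ _)
      (Set.mem_univ _) hJ₀.ne' hJpos.ne' hlt.le
    simp only [Pi.neg_apply, sub_zero] at hsec
    -- `hsec : (-f J₀ - -f 0) / J₀ ≤ (-f J - -f 0) / J`
    have h1 : c ≤ (f 0 - f J₀) / J₀ := by
      rw [le_div_iff₀ hJ₀]; exact h
    have h2 : (f 0 - f J₀) / J₀ ≤ (f 0 - f J) / J := by
      have e1 : (-f J₀ - -f 0) = f 0 - f J₀ := by ring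
      have e2 : (-f J - -f 0) = f 0 - f J := by ring
      rw [e1, e2] at hsec
      exact hsec
    have h3 : c ≤ (f 0 - f J) / J := h1.trans h2
    rwa [le_div_iff₀ hJpos] at h3

end Abstract

/-- **The range `J₀` in the hypothesis of `JmInterchange` is idle.**  At every `(U, δ)` and `a`, linear Josephson
gain of the window double on the coupling range `(0, J₀]` (pointwise onset, the crux's hypothesis verbatim) implies the
same gain, with the same constant `a`, on ANY range `(0, J₀']`: for `J ≤ J₀` there is nothing to do, and for `J > J₀` the
onset `L₀(J₀)` serves `J` by `gain_mono_coupling` (concavity of `E_L`).  Koma–Tasaki (1994). [folklore] -/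
theorem gainHyp_mono_range (U δ a J₀ J₀' : ℝ) (hJ₀ : 0 < J₀)
    (hG : ∀ J ∈ Set.Ioc (0:ℝ) J₀, ∃ L₀ : ℕ, ∀ (L : ℕ) [NeZero L], Even L → L₀ ≤ L → (let ι : Type := Finset (Literature.MathematicalPhysics.QuantumLattice.Orb (Literature.MathematicalPhysics.QuantumLattice.FermionTorus 2 L)); let N : ℕ := 2 * ⌊(1 - δ) * (L : ℝ) ^ 2 / 2⌋₊; let H : Matrix ι ι ℂ := Literature.MathematicalPhysics.QuantumLattice.hubbardTorus 2 L 1 U; let μ : ℝ := (H.minEnergyOn (Literature.MathematicalPhysics.QuantumLattice.szSector N 0) - H.minEnergyOn (Literature.MathematicalPhysics.QuantumLattice.szSector (N - 2) 0)) / 2; let A : Matrix ι ι ℂ := Literature.MathematicalPhysics.QuantumLattice.hubbardTorusWith 2 L 1 U μ; let D : Matrix ι ι ℂ := ((L : ℂ))⁻¹ • Literature.MathematicalPhysics.QuantumLattice.pairField Literature.MathematicalPhysics.QuantumLattice.dWaveFormFactor L; let Hd : ℝ → Matrix (ι × ι) (ι × ι) ℂ := fun J => Matrix.kroneckerMap (fun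 a b : ℂ => a * b) A 1 + Matrix.kroneckerMap (fun a b : ℂ => a * b) 1 (Matrix.transpose A) - (J : ℂ) • (Matrix.kroneckerMap (fun a b : ℂ => a * b) D (Matrix.transpose (Matrix.conjTranspose D)) + Matrix.kroneckerMap (fun a b : ℂ => a * b) (Matrix.conjTranspose D) (Matrix.transpose D)); let good : ι × ι → Prop := fun p => ((p.1.card = N ∧ p.2.card = N) ∨ (p.1.card = N - 2 ∧ p.2.card = N - 2)) ∧ (p.1.filter (fun o => (ofLex o).2 = 0)).card = (p.1.filter (fun o => (ofLex o).2 = 1)).card ∧ (p.2.filter (fun o => (ofLex o).2 = 0)).card = (p.2.filter (fun o => (ofLex o).2 = 1)).card; let S : Submodule ℂ (ι × ι → ℂ) := ⨅ (p : ι × ι) (_ : ¬ good p), LinearMap.ker (LinearMap.proj (R := ℂ) (φ := fun _ : ι × ι => ℂ) p); let E : ℝ → ℝ := fun J => (Hd J).minEnergyOn S; a * J * (L : ℝ) ^ 2 ≤ E 0 - E J)) :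
    ∀ J ∈ Set.Ioc (0:ℝ) J₀', ∃ L₀ : ℕ, ∀ (L : ℕ) [NeZero L], Even L → L₀ ≤ L → (let ι : Type := Finset (Literature.MathematicalPhysics.QuantumLattice.Orb (Literature.MathematicalPhysics.QuantumLattice.FermionTorus 2 L)); let N : ℕ := 2 * ⌊(1 - δ) * (L : ℝ) ^ 2 / 2⌋₊; let H : Matrix ι ι ℂ := Literature.MathematicalPhysics.QuantumLattice.hubbardTorus 2 L 1 U; let μ : ℝ := (H.minEnergyOn (Literature.MathematicalPhysics.QuantumLattice.szSector N 0) - H.minEnergyOn (Literature.MathematicalPhysics.QuantumLattice.szSector (N - 2) 0)) / 2; let A : Matrix ι ι ℂ := Literature.MathematicalPhysics.QuantumLattice.hubbardTorusWith 2 L 1 U μ; let D : Matrix ι ι ℂ := ((L : ℂ))⁻¹ • Literature.MathematicalPhysics.QuantumLattice.pairField Literature.MathematicalPhysics.QuantumLattice.dWaveFormFactor L; let Hd : ℝ → Matrix (ι × ι) (ι × ι) ℂ := fun J => Matrix.kroneckerMap (fun a b : ℂ => a * b) A 1 + Matrix.kroneckerMap (fun a b : ℂ => a * b) 1 (Matrix.transpose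 A) - (J : ℂ) • (Matrix.kroneckerMap (fun a b : ℂ => a * b) D (Matrix.transpose (Matrix.conjTranspose D)) + Matrix.kroneckerMap (fun a b : ℂ => a * b) (Matrix.conjTranspose D) (Matrix.transpose D)); let good : ι × ι → Prop := fun p => ((p.1.card = N ∧ p.2.card = N) ∨ (p.1.card = N - 2 ∧ p.2.card = N - 2)) ∧ (p.1.filter (fun o => (ofLex o).2 = 0)).card = (p.1.filter (fun o => (ofLex o).2 = 1)).card ∧ (p.2.filter (fun o => (ofLex o).2 = 0)).card = (p.2.filter (fun o => (ofLex o).2 = 1)).card; let S : Submodule ℂ (ι × ι → ℂ) := ⨅ (p : ι × ι) (_ : ¬ good p), LinearMap.ker (LinearMap.proj (R := ℂ) (φ := fun _ : ι × ι => ℂ) p); let E : ℝ → ℝ := fun J => (Hd J).minEnergyOn S; a * J * (L : ℝ) ^ 2 ≤ E 0 - E J) := by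
  intro J hJ
  by_cases hle : J ≤ J₀
  · -- inside the original range
    exact hG J ⟨hJ.1, hle⟩
  · -- beyond it: the onset of `J₀` serves `J`
    rw [not_le] at hle
    obtain ⟨L₀, hL₀⟩ := hG J₀ ⟨hJ₀, le_rfl⟩
    refine ⟨L₀, fun L _ hE hL => ?_⟩
    have hgain := hL₀ L hE hL
    extract_lets ι N H μ A D Hd good S E at hgain
    intro ι' N' H' μ' A' D' Hd' good' S' E'
    have hA : A.IsHermitian := isHermitian_hamiltonianWith (fermionTorusGraph 2 L) 1 U μ
    have hgain' : a * (L : ℝ) ^ 2 * J₀ ≤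
        (A ⊗ₖ (1 : Matrix ι ι ℂ) + (1 : Matrix ι ι ℂ) ⊗ₖ Aᵀ -
              ((0 : ℝ) : ℂ) • (D ⊗ₖ Dᴴᵀ + Dᴴ ⊗ₖ Dᵀ)).minEnergyOn S -
          (A ⊗ₖ (1 : Matrix ι ι ℂ) + (1 : Matrix ι ι ℂ) ⊗ₖ Aᵀ -
              (J₀ : ℂ) • (D ⊗ₖ Dᴴᵀ + Dᴴ ⊗ₖ Dᵀ)).minEnergyOn S := by
      have : a * (L : ℝ) ^ 2 * J₀ = a * J₀ * (L : ℝ) ^ 2 := by ring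
      rw [this]; exact hgain
    have key := gain_mono_coupling hA D S hJ₀ hle.le hgain'
    have : a * J * (L : ℝ) ^ 2 = a * (L : ℝ) ^ 2 * J := by ring
    show a * J * (L : ℝ) ^ 2 ≤ E' 0 - E' J
    rw [this]
    exact key

/-- **`JmInterchange` is its own instance `J₀ = 1`.**  Since the coupling range of the hypothesis is idle
(`gainHyp_mono_range`), the crux is equivalent to: at every `U > 0`, `δ ∈ (0, 1/2)`, `a > 0`, linear Josephson gain
`a J L² ≤ E_L(0) − E_L(J)` of the window double for all `J ∈ (0, 1]` (pointwise onset) implies the ground-floor pair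
bridge at `(U, δ)`.  Koma–Tasaki (1994) (the monotone family `(E(0) − E(J))/J`). [folklore] -/
theorem jmInterchange_iff_unitRange :
    Summit.HubbardSuperconductivity.HubbardSuperconductivity.Theses.JosephsonMirror.JmInterchange ↔
      ∀ (U δ a : ℝ), 0 < U → δ ∈ Set.Ioo (0:ℝ) (1 / 2) → 0 < a →
        (∀ J ∈ Set.Ioc (0:ℝ) 1, ∃ L₀ : ℕ, ∀ (L : ℕ) [NeZero L], Even L → L₀ ≤ L → (let ι : Type := Finset (Literature.MathematicalPhysics.QuantumLattice.Orb (Literature.MathematicalPhysics.QuantumLattice.FermionTorus 2 L)); let N : ℕ := 2 * ⌊(1 - δ) * (L : ℝ) ^ 2 / 2⌋₊; let H : Matrix ι ι ℂ := Literature.MathematicalPhysics.QuantumLattice.hubbardTorus 2 L 1 U; let μ : ℝ := (H.minEnergyOn (Literature.MathematicalPhysics.QuantumLattice.szSector N 0) - H.minEnergyOn (Literature.MathematicalPhysics.QuantumLattice.szSector (N - 2) 0)) / 2; let A : Matrix ι ι ℂ := Literature.MathematicalPhysics.QuantumLattice.hubbardTorusWith 2 L 1 U μ; let D : Matrix ι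 ι ℂ := ((L : ℂ))⁻¹ • Literature.MathematicalPhysics.QuantumLattice.pairField Literature.MathematicalPhysics.QuantumLattice.dWaveFormFactor L; let Hd : ℝ → Matrix (ι × ι) (ι × ι) ℂ := fun J => Matrix.kroneckerMap (fun a b : ℂ => a * b) A 1 + Matrix.kroneckerMap (fun a b : ℂ => a * b) 1 (Matrix.transpose A) - (J : ℂ) • (Matrix.kroneckerMap (fun a b : ℂ => a * b) D (Matrix.transpose (Matrix.conjTranspose D)) + Matrix.kroneckerMap (fun a b : ℂ => a * b) (Matrix.conjTranspose D) (Matrix.transpose D)); let good : ι × ι → Prop := fun p => ((p.1.card = N ∧ p.2.card = N) ∨ (p.1.card = N - 2 ∧ p.2.card = N - 2)) ∧ (p.1.filter (fun o => (ofLex o).2 = 0)).card = (p.1.filter (fun o => (ofLex o).2 = 1)).card ∧ (p.2.filter (fun o => (ofLex o).2 = 0)).card = (p.2.filter (fun o => (ofLex o).2 = 1)).card; let S : Submodule ℂ (ι × ι → ℂ) := ⨅ (p : ι × ι) (_ : ¬ good p), LinearMap.ker (LinearMap.proj (R := ℂ) (φ := fun _ : ι × ι => ℂ) p); let E : ℝ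 → ℝ := fun J => (Hd J).minEnergyOn S; a * J * (L : ℝ) ^ 2 ≤ E 0 - E J)) →
        ∃ a' : ℝ, 0 < a' ∧ ∃ L₀ : ℕ, ∀ (L : ℕ) [NeZero L], Even L → L₀ ≤ L → ∃ φ χ : Literature.MathematicalPhysics.QuantumLattice.Fock (Literature.MathematicalPhysics.QuantumLattice.Orb (Literature.MathematicalPhysics.QuantumLattice.FermionTorus 2 L)), Literature.MathematicalPhysics.QuantumLattice.IsGroundStateInSector (Literature.MathematicalPhysics.QuantumLattice.hubbardTorus 2 L 1 U) (2 * ⌊(1 - δ) * (L : ℝ) ^ 2 / 2⌋₊) 0 φ ∧ star φ ⬝ᵥ φ = 1 ∧ Literature.MathematicalPhysics.QuantumLattice.IsGroundStateInSector (Literature.MathematicalPhysics.QuantumLattice.hubbardTorus 2 L 1 U) (2 * ⌊(1 - δ) * (L : ℝ) ^ 2 / 2⌋₊ - 2) 0 χ ∧ star χ ⬝ᵥ χ = 1 ∧ a' * (L : ℝ) ^ 4 ≤ ‖star χ ⬝ᵥ Matrix.mulVec (Literature.MathematicalPhysics.QuantumLattice.pairField Literature.MathematicalPhysics.QuantumLattice.dWaveFormFactor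 L) φ‖ ^ 2 := by
  constructor
  · intro hI U δ a hU hδ ha hG
    exact hI U δ a 1 hU hδ ha one_pos hG
  · intro h
    unfold JmInterchange
    intro U δ a J₀ hU hδ ha hJ₀ hG
    exact h U δ a hU hδ ha (gainHyp_mono_range U δ a J₀ 1 hJ₀ hG)

end Summit.HubbardSuperconductivity.HubbardSuperconductivity.Theorems.JosephsonMirror
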